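import Literature.Computability.AlgebraicComplexity.LMR13BoundaryFormNotCone
import Literature.LinearAlgebra.Matrix.PfaffianAdjugate
import HarnessLib

/-!
# LMR 2013, Prop. 3.5.2, the `⊆` half: every tangent hyperplane of `Z(P_Λ)` is `v² ⊕ v ∧ w`

Cell val-lit (D-0074), row LMR13-A (lead-lmr ASSIGN 2026-08-26T09:16:43Z; the separable piece named
by the row's typer t11 g2, 09:15:44Z). Companion (theorems only + private plumbing; no named facts;
no edits to the typer's files) of `LMR13DualVarieties.lean`, where Landsberg–Manivel–Ressayre 2013,
Prop. 3.5.2 (Comment. Math. Helv. 88, p. 481: "The dual variety of the hypersurface `Z(P_Λ)` is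
isomorphic to the Zariski closure of `ℙ{v² ⊕ v∧w ∈ S²ℂⁿ ⊕ Λ²ℂⁿ, v, w ∈ ℂⁿ} ⊂ ℙ(M_n(ℂ))`") is the
named fact `LMR2013_prop_3_5_2` (`∃ g` linear automorphism, `g '' dualVarietyCone (pLambda n) =
zariskiClosure (vSqWedgeSet n)`, `n` odd `≥ 3`).

PROVED here, for every odd `n` and with `g = id`:

* `gradAt_pLambda_mem_vSqWedgeSet` — at every zero `x` of `P_Λ` the gradient `∇P_Λ(x) ∈ M_n(ℂ)` is
  of the form `(v_i v_j + (v_i w_j − v_j w_i))_{ij}`, i.e. lies in `vSqWedgeSet n`;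
* `tangentHyperplaneCone_pLambda_subset : tangentHyperplaneCone (pLambda n) ⊆ vSqWedgeSet n`;
* `dualVarietyCone_pLambda_subset : dualVarietyCone (pLambda n) ⊆ zariskiClosure (vSqWedgeSet n)`
  (`zariskiClosure_mono`), and `LMR2013_prop_3_5_2_subset` (the `∃ g` shape, `g = LinearEquiv.refl`).

This is the inclusion `⊆` of the printed statement ("It can be defined as the image of the
projective bundle …", p. 481). The reverse inclusion (the image of `(v, w) ↦ v² ⊕ v ∧ w` is DENSE in
the dual variety) is NOT proved in the first part of this file (first landing: PARTIAL discharge).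

**Second landing (Appendix below, same seat): the `⊇` half IS proved and the named fact is DISCHARGED —
`LMR2013_prop_3_5_2_holds : LMR2013_prop_3_5_2`** (`n` odd, `n ≥ 3`, `g = id`), via the `GL_n`-covariance
of `∇P_Λ` (`gradAt_pLambda_conj`, `conj_mem_tangentHyperplaneCone_pLambda`), one explicit tangent
hyperplane `v₀² ⊕ v₀ ∧ w₀` with `v₀, w₀` independent (`exists_indep_mem_tangentHyperplaneCone_pLambda`,
at `A₀ = lmrSkewStd`), transitivity of `GL_n` on such pairs, and density
(`vSqWedgeSet_subset_dualVarietyCone_pLambda`). The docstrings of the first part are kept as landed.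

## Proof

Write `M = A + S` (skew + symmetric parts, `skewPt`/`symPt`) and recall the typer's closed form
`P_Λ(M) = (1/n)·tr(adj(A)·S)` over any `ℂ`-algebra (`aeval_pLambda`, `LMR13BoundaryFormNotCone.lean`).
For `n = m + 1` odd, `adj(A) = z zᵀ` with `z = z(A)` the vector of signed principal sub-Pfaffians
(`Literature.LinearAlgebra.Matrix.adjugate_eq_vecMulVec_pfVec`, `PfaffianAdjugate.lean` — LMR's
"`P_Λ = Σ s_{ij} Pf_i(A) Pf_j(A)`", p. 480), also over `ℂ[ε]`. Differentiating
`P_Λ(x + ε E_{ij}) = (1/n)·z(ε)ᵀ (S + ε T_{ij}) z(ε)` at `ε = 0` (first-order Taylor expansion,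
`eval_zero_derivative_aeval_linePt`) gives `∂_{ij}P_Λ(x) = (1/n)(z₀_i z₀_j + 2 z₀ᵀ S z₁)`
(`gradAt_pLambda_eq`), where `z₀ = z(A)` and `z₁ = ż(0)` satisfies `A z₁ = −B_{ij} z₀`
(`skewPt_mulVec_dv0`, from `(A + εB) z(ε) = 0`, `mulVec_pfVec_eq_zero`). If `z₀ = 0` the gradient
vanishes. Otherwise `adj(A) = z₀z₀ᵀ ≠ 0`, so `rank A ≥ n − 1` (`le_rank_of_adjugate_ne_zero`) and
`im A = z₀^⊥` (dimension count, `exists_mulVec_eq_of_dotProduct_eq_zero`); since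
`z₀ᵀ S z₀ = n·P_Λ(x) = 0` there is `q` with `A q = S z₀`, whence `z₀ᵀ S z₁ = qᵀ B_{ij} z₀ =
(q_i z₀_j − q_j z₀_i)/2` and `∇P_Λ(x) = (1/n)(z₀ z₀ᵀ + q ∧ z₀)`; take `v = z₀/√n`, `w = −q/√n`.

Honest framing: a partial discharge (one inclusion) of a printed statement about the boundary form
`P_Λ` of the determinant orbit closure; it proves nothing about `dc(per)`, and VP ≠ VNP is NOT
proved — nothing here is progress on it.

## References

* J. M. Landsberg, L. Manivel, N. Ressayre, *Hypersurfaces with degenerate duals and the geometric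
  complexity theory program*, Comment. Math. Helv. 88 (2013) 469–484, §3.5, Prop. 3.5.2 (p. 481).
  [cite: LandsbergManivelRessayre2013, Proposition 3.5.2 (p. 481)]
* R. A. Horn, C. R. Johnson, *Matrix Analysis*, 2nd ed., CUP 2013, §0.8.5 (adjugate; rank facts).
-/
noncomputable section

open MvPolynomial Matrix

namespace Literature.Computability.AlgebraicComplexity

open _root_.Literature.NumberTheory.DiophantineGeometry
open _root_.Literature.LinearAlgebra.Matrix

/-! ### First-order Taylor expansion along a line, via `ℂ[ε]` -/

section Taylor

variable {K : Type*} [Field K] {σ : Type*}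

/-- The `K[ε]`-point `x + ε d` of the line through `x` with direction `d`. [folklore] -/
private def linePt (x d : σ → K) : σ → Polynomial K :=
  fun k => Polynomial.C (x k) + Polynomial.C (d k) * Polynomial.X

/-- Unfolding of `linePt`. [folklore] -/
private theorem linePt_apply (x d : σ → K) (k : σ) :
    linePt x d k = Polynomial.C (x k) + Polynomial.C (d k) * Polynomial.X := rfl

/-- `f(x + ε d)|_{ε = 0} = f(x)`. [folklore] -/
private theorem eval_zero_aeval_linePt (f : MvPolynomial σ K) (x d : σ → K) :
    Polynomial.eval 0 (aeval (linePt x d) f) = eval x f := by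
  induction f using MvPolynomial.induction_on with
  | C c => simp
  | add p q hp hq => rw [map_add, Polynomial.eval_add, hp, hq, map_add]
  | mul_X p k hp =>
    rw [map_mul, aeval_X, Polynomial.eval_mul, hp, map_mul, eval_X, linePt_apply]
    simp

/-- **Directional derivative**: `d/dε f(x + ε d)|_{ε=0} = Σ_k d_k (∂_k f)(x)` (first-order Taylor
expansion). [folklore] -/
private theorem eval_zero_derivative_aeval_linePt [Fintype σ] [DecidableEq σ] (f : MvPolynomial σ K)
    (x d : σ → K) :
    Polynomial.eval 0 (Polynomial.derivative (aeval (linePt x d) f)) =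
      ∑ k, d k * eval x (pderiv k f) := by
  induction f using MvPolynomial.induction_on with
  | C c => simp
  | add p q hp hq =>
    rw [map_add, Polynomial.derivative_add, Polynomial.eval_add, hp, hq, ← Finset.sum_add_distrib]
    refine Finset.sum_congr rfl fun k _ => ?_
    rw [map_add, map_add]
    ring
  | mul_X p k hp =>
    rw [map_mul, aeval_X, Polynomial.derivative_mul, Polynomial.eval_add, Polynomial.eval_mul,
      Polynomial.eval_mul, hp, eval_zero_aeval_linePt, linePt_apply]
    have h1 : Polynomial.eval 0 (Polynomial.C (x k) + Polynomial.C (d k) * Polynomial.X) = x k := by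
      simp
    have h2 : Polynomial.eval 0 (Polynomial.derivative
        (Polynomial.C (x k) + Polynomial.C (d k) * Polynomial.X)) = d k := by
      simp
    rw [h1, h2]
    have h3 : ∀ k' : σ, eval x (pderiv k' (p * X k)) =
        eval x (pderiv k' p) * x k + eval x p * (if k' = k then 1 else 0) := by
      intro k'
      rw [(pderiv k').leibniz, pderiv_X, smul_eq_mul, smul_eq_mul, map_add, map_mul, map_mul, eval_X]
      by_cases h : k' = k
      · subst h
        rw [if_pos rfl, Pi.single_eq_same, map_one]
        ring
      · have h' : k ≠ k' := fun e => h e.symm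
        rw [if_neg h, Pi.single_eq_of_ne h', map_zero]
        ring
    simp_rw [h3, mul_add, Finset.sum_add_distrib, mul_ite, mul_one, mul_zero, Finset.sum_ite_eq',
      Finset.mem_univ, if_true, Finset.sum_mul]
    congr 1
    · exact Finset.sum_congr rfl fun k' _ => by ring
    · ring

/-- The gradient entry as a directional derivative along the coordinate direction.
[folklore] -/
private theorem gradAt_eq_eval_zero_derivative [Fintype σ] [DecidableEq σ] (f : MvPolynomial σ K)
    (x : σ → K) (k₀ : σ) :
    gradAt f x k₀ = Polynomial.eval 0 (Polynomial.derivative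
      (aeval (linePt x (fun k => if k = k₀ then 1 else 0)) f)) := by
  rw [eval_zero_derivative_aeval_linePt, gradAt_apply]
  simp [Finset.sum_ite_eq', ite_mul]

end Taylor

/-! ### Matrices of linear polynomials `P + ε Q` and their first-order calculus -/

section MLine

variable {ι : Type*}

/-- The matrix `P + ε Q` with entries in `ℂ[ε]`. [folklore] -/
private def mline (P Q : Matrix ι ι ℂ) : Matrix ι ι (Polynomial ℂ) :=
  Matrix.of fun a b => Polynomial.C (P a b) + Polynomial.C (Q a b) * Polynomial.X

/-- Entries of `mline`. [folklore] -/
private theorem mline_apply (P Q : Matrix ι ι ℂ) (a b : ι) :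
    mline P Q a b = Polynomial.C (P a b) + Polynomial.C (Q a b) * Polynomial.X := rfl

/-- `(P + εQ)|_{ε=0} = P`. [folklore] -/
private theorem mline_map_eval_zero (P Q : Matrix ι ι ℂ) :
    (mline P Q).map (Polynomial.eval 0) = P := by
  ext a b
  simp [mline_apply]

/-- `(P + εQ)ᵀ = Pᵀ + εQᵀ`. [folklore] -/
private theorem mline_transpose (P Q : Matrix ι ι ℂ) : (mline P Q)ᵀ = mline Pᵀ Qᵀ := by
  ext a b
  simp [mline_apply]

/-- `P + εQ` is alternating when `P`, `Q` are. [folklore] -/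
private theorem mline_transpose_eq_neg {P Q : Matrix ι ι ℂ} (hP : Pᵀ = -P) (hQ : Qᵀ = -Q) :
    (mline P Q)ᵀ = -mline P Q := by
  rw [mline_transpose, hP, hQ]
  refine Matrix.ext fun a b => ?_
  rw [Matrix.neg_apply, mline_apply, mline_apply, Matrix.neg_apply, Matrix.neg_apply, map_neg, map_neg]
  ring

/-- … with zero diagonal. [folklore] -/
private theorem mline_apply_self {P Q : Matrix ι ι ℂ} (hP : ∀ a, P a a = 0) (hQ : ∀ a, Q a a = 0)
    (a : ι) : mline P Q a a = 0 := by
  simp [mline_apply, hP a, hQ a]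

/-- For a vector `u ∈ ℂ[ε]^ι`, its value and its derivative at `ε = 0`. [folklore] -/
private def ev0 (u : ι → Polynomial ℂ) : ι → ℂ := fun a => Polynomial.eval 0 (u a)

/-- See `ev0`. [folklore] -/
private def dv0 (u : ι → Polynomial ℂ) : ι → ℂ := fun a => Polynomial.eval 0 (Polynomial.derivative (u a))

/-- `d/dε [uᵀ (S + εT) u]|₀ = u₁ᵀ S u₀ + u₀ᵀ T u₀ + u₀ᵀ S u₁`. [folklore] -/
private theorem eval_zero_derivative_dotProduct_mline_mulVec [Fintype ι] (S T : Matrix ι ι ℂ)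
    (u : ι → Polynomial ℂ) :
    Polynomial.eval 0 (Polynomial.derivative (u ⬝ᵥ (mline S T *ᵥ u))) =
      dv0 u ⬝ᵥ (S *ᵥ ev0 u) + ev0 u ⬝ᵥ (T *ᵥ ev0 u) + ev0 u ⬝ᵥ (S *ᵥ dv0 u) := by
  simp only [dotProduct, mulVec, Finset.mul_sum, Polynomial.derivative_sum, Polynomial.eval_finsetSum,
    ← Finset.sum_add_distrib]
  refine Finset.sum_congr rfl fun a _ => Finset.sum_congr rfl fun b _ => ?_
  simp only [mline_apply, ev0, dv0, Polynomial.derivative_mul, Polynomial.derivative_add,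
    Polynomial.derivative_C, Polynomial.derivative_X, zero_add, Polynomial.eval_add,
    Polynomial.eval_mul, Polynomial.eval_C, Polynomial.eval_X, mul_zero, add_zero, mul_one]
  ring

/-- `d/dε [(A + εB) u]|₀ = B u₀ + A u₁`. [folklore] -/
private theorem eval_zero_derivative_mline_mulVec [Fintype ι] (A B : Matrix ι ι ℂ) (u : ι → Polynomial ℂ) (a : ι) :
    Polynomial.eval 0 (Polynomial.derivative ((mline A B *ᵥ u) a)) =
      (B *ᵥ ev0 u) a + (A *ᵥ dv0 u) a := by
  simp only [mulVec, dotProduct, Polynomial.derivative_sum, Polynomial.eval_finsetSum,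
    ← Finset.sum_add_distrib]
  refine Finset.sum_congr rfl fun b _ => ?_
  simp only [mline_apply, ev0, dv0, Polynomial.derivative_mul, Polynomial.derivative_add,
    Polynomial.derivative_C, Polynomial.derivative_X, zero_add, Polynomial.eval_add,
    Polynomial.eval_mul, Polynomial.eval_C, Polynomial.eval_X, mul_zero, add_zero, mul_one]

/-- `[(A + εB) u]|₀ = A u₀`. [folklore] -/
private theorem eval_zero_mline_mulVec [Fintype ι] (A B : Matrix ι ι ℂ) (u : ι → Polynomial ℂ) (a : ι) :
    Polynomial.eval 0 ((mline A B *ᵥ u) a) = (A *ᵥ ev0 u) a := by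
  simp only [mulVec, dotProduct, Polynomial.eval_finsetSum]
  refine Finset.sum_congr rfl fun b _ => ?_
  simp [mline_apply, ev0]

/-- `tr((z zᵀ) S) = zᵀ S z` (any square `S`). [folklore] -/
private theorem trace_vecMulVec_mul [Fintype ι] {R : Type*} [CommRing R] (z : ι → R)
    (S : Matrix ι ι R) : (vecMulVec z z * S).trace = z ⬝ᵥ (S *ᵥ z) := by
  simp only [trace, diag, mul_apply, vecMulVec_apply, dotProduct, mulVec, Finset.mul_sum]
  rw [Finset.sum_comm]
  refine Finset.sum_congr rfl fun a _ => Finset.sum_congr rfl fun b _ => ?_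
  ring

end MLine

/-! ### Linear algebra: rank from a nonzero cofactor; solvability on the orthogonal of the kernel -/

section LinAlg

variable {K : Type*} [Field K] {m : ℕ}

/-- A nonzero cofactor of an `(m+1) × (m+1)` matrix forces `rank ≥ m` (the complementary
`m × m` minor is invertible). [cite: HornJohnson2013, §0.8.5 (the adjugate: rank facts)] -/
private theorem le_rank_of_adjugate_ne_zero {A : Matrix (Fin (m + 1)) (Fin (m + 1)) K}
    {k l : Fin (m + 1)} (h : A.adjugate k l ≠ 0) : m ≤ A.rank := by
  rw [adjugate_fin_succ_eq_det_submatrix] at h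
  have hdet : (A.submatrix l.succAbove k.succAbove).det ≠ 0 := fun h0 => h (by rw [h0, mul_zero])
  have hunit : IsUnit (A.submatrix l.succAbove k.succAbove) :=
    (Matrix.isUnit_iff_isUnit_det _).mpr (isUnit_iff_ne_zero.mpr hdet)
  have hr := Matrix.rank_of_isUnit _ hunit
  rw [Fintype.card_fin] at hr
  have hle := Matrix.rank_submatrix_le A l.succAbove k.succAbove
  omega

/-- **Solvability on `u^⊥`**: if `A` is skew, `A u = 0`, `u ≠ 0` and `rank A ≥ m` (so that
`ker A = K u` and `im A = u^⊥`), then every `y` with `u · y = 0` is of the form `A q` (dimension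
count: `im A ⊆ u^⊥`, both of dimension `m`). [folklore] -/
private theorem exists_mulVec_eq_of_dotProduct_eq_zero {A : Matrix (Fin (m + 1)) (Fin (m + 1)) K}
    (hA : Aᵀ = -A) {u : Fin (m + 1) → K} (hu : u ≠ 0) (hAu : A *ᵥ u = 0) (hr : m ≤ A.rank)
    {y : Fin (m + 1) → K} (hy : u ⬝ᵥ y = 0) : ∃ q, A *ᵥ q = y := by
  classical
  set Ru : Matrix Unit (Fin (m + 1)) K := Matrix.of fun _ j => u j with hRu
  have hφ : ∀ v, Ru.mulVecLin v = fun _ => u ⬝ᵥ v := by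
    intro v
    funext t
    rw [Matrix.mulVecLin_apply]
    rfl
  have hle : LinearMap.range A.mulVecLin ≤ LinearMap.ker Ru.mulVecLin := by
    rintro _ ⟨v, rfl⟩
    rw [LinearMap.mem_ker, hφ]
    funext t
    rw [Matrix.mulVecLin_apply, dotProduct_mulVec, ← mulVec_transpose, hA, neg_mulVec, hAu, neg_zero,
      zero_dotProduct, Pi.zero_apply]
  have htop : LinearMap.range Ru.mulVecLin = ⊤ := by
    obtain ⟨a, ha⟩ := Function.ne_iff.mp hu
    rw [eq_top_iff]
    rintro c -
    refine ⟨(c () / u a) • Pi.single a 1, ?_⟩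
    rw [hφ]
    funext t
    rw [dotProduct_smul, dotProduct_single_one, smul_eq_mul, div_mul_cancel₀ _ ha]
  have hker : Module.finrank K (LinearMap.ker Ru.mulVecLin) = m := by
    have h1 := LinearMap.finrank_range_add_finrank_ker Ru.mulVecLin
    rw [htop, finrank_top, Module.finrank_fintype_fun_eq_card, Module.finrank_fintype_fun_eq_card,
      Fintype.card_unit, Fintype.card_fin] at h1
    omega
  have heq : LinearMap.range A.mulVecLin = LinearMap.ker Ru.mulVecLin := by
    apply Submodule.eq_of_le_of_finrank_le hle
    rw [hker]
    exact hr
  have hyk : y ∈ LinearMap.ker Ru.mulVecLin := by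
    rw [LinearMap.mem_ker, hφ]
    funext t
    rw [hy, Pi.zero_apply]
  rw [← heq] at hyk
  obtain ⟨q, hq⟩ := hyk
  exact ⟨q, by rw [← Matrix.mulVecLin_apply]; exact hq⟩

end LinAlg

/-! ### The point data of `P_Λ`: `M = A + S`, the coordinate directions, the Pfaffian vector -/

section PLambdaData

variable {m : ℕ}

/-- The matrix `M` of a point `x ∈ M_n(ℂ) = (Fin n × Fin n → ℂ)`. [folklore] -/
private def ptMat (x : Fin (m + 1) × Fin (m + 1) → ℂ) : Matrix (Fin (m + 1)) (Fin (m + 1)) ℂ :=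
  Matrix.of fun a b => x (a, b)

/-- The skew part `A = (M − Mᵀ)/2`. [cite: LandsbergManivelRessayre2013, §3.5 (p. 480)] -/
private def skewPt (x : Fin (m + 1) × Fin (m + 1) → ℂ) : Matrix (Fin (m + 1)) (Fin (m + 1)) ℂ :=
  (1 / 2 : ℂ) • (ptMat x - (ptMat x)ᵀ)

/-- The symmetric part `S = (M + Mᵀ)/2`. [cite: LandsbergManivelRessayre2013, §3.5 (p. 480)] -/
private def symPt (x : Fin (m + 1) × Fin (m + 1) → ℂ) : Matrix (Fin (m + 1)) (Fin (m + 1)) ℂ :=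
  (1 / 2 : ℂ) • (ptMat x + (ptMat x)ᵀ)

/-- The coordinate direction `E_{ij}`. [folklore] -/
private def dirMat (i j : Fin (m + 1)) : Matrix (Fin (m + 1)) (Fin (m + 1)) ℂ :=
  Matrix.of fun a b => if a = i ∧ b = j then 1 else 0

/-- Its skew part `(E_{ij} − E_{ji})/2`. [folklore] -/
private def dirSkew (i j : Fin (m + 1)) : Matrix (Fin (m + 1)) (Fin (m + 1)) ℂ :=
  (1 / 2 : ℂ) • (dirMat i j - (dirMat i j)ᵀ)

/-- Its symmetric part `(E_{ij} + E_{ji})/2`. [folklore] -/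
private def dirSym (i j : Fin (m + 1)) : Matrix (Fin (m + 1)) (Fin (m + 1)) ℂ :=
  (1 / 2 : ℂ) • (dirMat i j + (dirMat i j)ᵀ)

/-- The Pfaffian vector of the skew part along the line `A + ε B_{ij}`, with values in `ℂ[ε]`.
[cite: LandsbergManivelRessayre2013, §3.5 (p. 480)] -/
private def zLine (x : Fin (m + 1) × Fin (m + 1) → ℂ) (i j : Fin (m + 1)) : Fin (m + 1) → Polynomial ℂ :=
  pfVec (mline (skewPt x) (dirSkew i j))

omit m in
/-- `(½ (P − Pᵀ))ᵀ = −½ (P − Pᵀ)`. [folklore] -/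
private theorem transpose_half_sub {ι : Type*} (P : Matrix ι ι ℂ) :
    ((1 / 2 : ℂ) • (P - Pᵀ))ᵀ = -((1 / 2 : ℂ) • (P - Pᵀ)) := by
  rw [transpose_smul, transpose_sub, transpose_transpose, ← smul_neg, neg_sub]

omit m in
/-- `(½ (P + Pᵀ))ᵀ = ½ (P + Pᵀ)`. [folklore] -/
private theorem transpose_half_add {ι : Type*} (P : Matrix ι ι ℂ) :
    ((1 / 2 : ℂ) • (P + Pᵀ))ᵀ = (1 / 2 : ℂ) • (P + Pᵀ) := by
  rw [transpose_smul, transpose_add, transpose_transpose, add_comm]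

omit m in
/-- `½ (P − Pᵀ)` has zero diagonal. [folklore] -/
private theorem half_sub_apply_self {ι : Type*} (P : Matrix ι ι ℂ) (a : ι) :
    ((1 / 2 : ℂ) • (P - Pᵀ)) a a = 0 := by
  simp

/-- The `ℂ[ε]`-point of the coordinate line `x + ε e_{(i,j)}` is the matrix `M + ε E_{ij}`.
[folklore] -/
private theorem linePt_eq_mline (x : Fin (m + 1) × Fin (m + 1) → ℂ) (i j : Fin (m + 1)) :
    linePt x (fun p => if p = (i, j) then 1 else 0) =
      fun p : Fin (m + 1) × Fin (m + 1) => mline (ptMat x) (dirMat i j) p.1 p.2 := by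
  funext p
  obtain ⟨a, b⟩ := p
  rw [linePt_apply, mline_apply]
  simp only [ptMat, dirMat, Matrix.of_apply, Prod.mk.injEq]

/-- Skew part of `M + ε E_{ij}` is `A + ε B_{ij}`. [folklore] -/
private theorem half_sub_mline (x : Fin (m + 1) × Fin (m + 1) → ℂ) (i j : Fin (m + 1)) :
    (1 / 2 : ℂ) • (mline (ptMat x) (dirMat i j) - (mline (ptMat x) (dirMat i j))ᵀ) =
      mline (skewPt x) (dirSkew i j) := by
  rw [mline_transpose]
  refine Matrix.ext fun a b => ?_
  simp only [skewPt, dirSkew, Matrix.smul_apply, Matrix.sub_apply, mline_apply, Matrix.transpose_apply,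
    Polynomial.smul_eq_C_mul, map_sub, map_mul, smul_eq_mul]
  ring

/-- Symmetric part of `M + ε E_{ij}` is `S + ε T_{ij}`. [folklore] -/
private theorem half_add_mline (x : Fin (m + 1) × Fin (m + 1) → ℂ) (i j : Fin (m + 1)) :
    (1 / 2 : ℂ) • (mline (ptMat x) (dirMat i j) + (mline (ptMat x) (dirMat i j))ᵀ) =
      mline (symPt x) (dirSym i j) := by
  rw [mline_transpose]
  refine Matrix.ext fun a b => ?_
  simp only [symPt, dirSym, Matrix.smul_apply, Matrix.add_apply, mline_apply, Matrix.transpose_apply,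
    Polynomial.smul_eq_C_mul, map_add, map_mul, smul_eq_mul]
  ring

/-- `2` is a unit of `ℂ[ε]`. [folklore] -/
private theorem isUnit_two_polynomial : IsUnit (2 : Polynomial ℂ) := by
  rw [← map_ofNat Polynomial.C 2]
  exact Polynomial.isUnit_C.mpr (isUnit_iff_ne_zero.mpr two_ne_zero)

/-- `adj(A + ε B_{ij}) = z(ε) z(ε)ᵀ` over `ℂ[ε]` (the Pfaffian description of the adjugate of an odd
alternating matrix, `adjugate_eq_vecMulVec_pfVec`). [cite: LandsbergManivelRessayre2013, §3.5 (p. 480)] -/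
private theorem adjugate_mline_skew (hm : Even m) (x : Fin (m + 1) × Fin (m + 1) → ℂ) (i j : Fin (m + 1)) :
    (mline (skewPt x) (dirSkew i j)).adjugate = vecMulVec (zLine x i j) (zLine x i j) :=
  adjugate_eq_vecMulVec_pfVec hm isUnit_two_polynomial
    (mline_transpose_eq_neg (transpose_half_sub _) (transpose_half_sub _))
    (mline_apply_self (half_sub_apply_self _) (half_sub_apply_self _))

/-- `z(0) = z(A)`, the Pfaffian vector of the skew part itself (Pfaffians commute with the ring map
`ε ↦ 0`). [cite: LandsbergManivelRessayre2013, §3.5 (p. 480)] -/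
private theorem ev0_zLine (x : Fin (m + 1) × Fin (m + 1) → ℂ) (i j : Fin (m + 1)) :
    ev0 (zLine x i j) = pfVec (skewPt x) := by
  funext k
  simp only [ev0, zLine, pfVec_apply, Polynomial.eval_mul, Polynomial.eval_pow, Polynomial.eval_neg,
    Polynomial.eval_one]
  congr 1
  rw [← Polynomial.coe_evalRingHom, ← pfaffian_map, ← Matrix.submatrix_map, Polynomial.coe_evalRingHom,
    mline_map_eval_zero]

/-- **First-order relation** `A z₁ = −B_{ij} z₀`: differentiate `(A + εB) z(ε) = 0` at `ε = 0`.
[cite: LandsbergManivelRessayre2013, Proposition 3.5.2, proof (p. 481)] -/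
private theorem skewPt_mulVec_dv0 (hm : Even m) (x : Fin (m + 1) × Fin (m + 1) → ℂ) (i j : Fin (m + 1)) :
    skewPt x *ᵥ dv0 (zLine x i j) = -(dirSkew i j *ᵥ pfVec (skewPt x)) := by
  have hz : mline (skewPt x) (dirSkew i j) *ᵥ zLine x i j = 0 :=
    mulVec_pfVec_eq_zero hm isUnit_two_polynomial
      (mline_transpose_eq_neg (transpose_half_sub _) (transpose_half_sub _))
      (mline_apply_self (half_sub_apply_self _) (half_sub_apply_self _))
  rw [← ev0_zLine x i j, eq_neg_iff_add_eq_zero]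
  funext a
  have h := eval_zero_derivative_mline_mulVec (skewPt x) (dirSkew i j) (zLine x i j) a
  rw [hz, Pi.zero_apply, Polynomial.derivative_zero, Polynomial.eval_zero] at h
  rw [Pi.add_apply, Pi.zero_apply, add_comm]
  exact h.symm

/-- **The gradient of `P_Λ`** at `x`, entry `(i,j)`:
`∂_{ij} P_Λ(x) = (1/n) · (z₁ᵀ S z₀ + z₀ᵀ T_{ij} z₀ + z₀ᵀ S z₁)` with `z₀ = z(A)`, `z₁ = ż(0)` along
`A + ε B_{ij}` (from `P_Λ(M) = (1/n) tr(adj(A) S)` over `ℂ[ε]` and `adj = z zᵀ`).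
[cite: LandsbergManivelRessayre2013, §3.5 and Proposition 3.5.2 (pp. 480–481)] -/
private theorem gradAt_pLambda_eq (hm : Even m) (x : Fin (m + 1) × Fin (m + 1) → ℂ) (i j : Fin (m + 1)) :
    gradAt (pLambda (m + 1)) x (i, j) =
      (1 / ((m + 1 : ℕ) : ℂ)) *
        (dv0 (zLine x i j) ⬝ᵥ (symPt x *ᵥ pfVec (skewPt x)) +
          pfVec (skewPt x) ⬝ᵥ (dirSym i j *ᵥ pfVec (skewPt x)) +
          pfVec (skewPt x) ⬝ᵥ (symPt x *ᵥ dv0 (zLine x i j))) := by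
  rw [gradAt_eq_eval_zero_derivative, linePt_eq_mline, aeval_pLambda, half_sub_mline, half_add_mline,
    adjugate_mline_skew hm, trace_vecMulVec_mul, Polynomial.derivative_smul, Polynomial.eval_smul,
    eval_zero_derivative_dotProduct_mline_mulVec, ev0_zLine, smul_eq_mul]

/-- `zᵀ T_{ij} z = z_i z_j`. [folklore] -/
private theorem dotProduct_dirSym_mulVec (i j : Fin (m + 1)) (z : Fin (m + 1) → ℂ) :
    z ⬝ᵥ (dirSym i j *ᵥ z) = z i * z j := by
  have h1 : dirMat i j *ᵥ z = fun a => if a = i then z j else 0 := by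
    funext a
    simp only [mulVec, dotProduct, dirMat, Matrix.of_apply]
    by_cases ha : a = i
    · simp [ha]
    · simp [ha]
  have h2 : (dirMat i j)ᵀ *ᵥ z = fun a => if a = j then z i else 0 := by
    funext a
    simp only [mulVec, dotProduct, dirMat, Matrix.transpose_apply, Matrix.of_apply]
    by_cases ha : a = j
    · simp [ha]
    · simp [ha]
  rw [dirSym, smul_mulVec, add_mulVec, h1, h2, dotProduct_smul, smul_eq_mul]
  simp only [dotProduct, Pi.add_apply, mul_add, mul_ite, mul_zero, Finset.sum_add_distrib,
    Finset.sum_ite_eq', Finset.mem_univ, if_true]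
  ring

/-- `qᵀ B_{ij} z = (q_i z_j − q_j z_i)/2`. [folklore] -/
private theorem dotProduct_dirSkew_mulVec (i j : Fin (m + 1)) (q z : Fin (m + 1) → ℂ) :
    q ⬝ᵥ (dirSkew i j *ᵥ z) = (1 / 2 : ℂ) * (q i * z j - q j * z i) := by
  have h1 : dirMat i j *ᵥ z = fun a => if a = i then z j else 0 := by
    funext a
    simp only [mulVec, dotProduct, dirMat, Matrix.of_apply]
    by_cases ha : a = i
    · simp [ha]
    · simp [ha]
  have h2 : (dirMat i j)ᵀ *ᵥ z = fun a => if a = j then z i else 0 := by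
    funext a
    simp only [mulVec, dotProduct, dirMat, Matrix.transpose_apply, Matrix.of_apply]
    by_cases ha : a = j
    · simp [ha]
    · simp [ha]
  rw [dirSkew, smul_mulVec, sub_mulVec, h1, h2, dotProduct_smul, smul_eq_mul]
  simp only [dotProduct, Pi.sub_apply, mul_sub, mul_ite, mul_zero, Finset.sum_sub_distrib,
    Finset.sum_ite_eq', Finset.mem_univ, if_true]

/-- `P_Λ(x) = (1/n) · z₀ᵀ S z₀`. [cite: LandsbergManivelRessayre2013, §3.5 (p. 480)] -/
private theorem eval_pLambda_eq_dotProduct (hm : Even m) (x : Fin (m + 1) × Fin (m + 1) → ℂ) :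
    eval x (pLambda (m + 1)) =
      (1 / ((m + 1 : ℕ) : ℂ)) * (pfVec (skewPt x) ⬝ᵥ (symPt x *ᵥ pfVec (skewPt x))) := by
  have hx : x = fun p : Fin (m + 1) × Fin (m + 1) => ptMat x p.1 p.2 := by
    funext p; simp [ptMat]
  conv_lhs => rw [hx]
  rw [eval_pLambda]
  change 1 / ((m + 1 : ℕ) : ℂ) * ((skewPt x).adjugate * symPt x).trace = _
  have hT : (skewPt x)ᵀ = -skewPt x := transpose_half_sub _
  have hd : ∀ a, skewPt x a a = 0 := half_sub_apply_self _
  rw [adjugate_eq_vecMulVec_pfVec hm (isUnit_iff_ne_zero.mpr two_ne_zero) hT hd, trace_vecMulVec_mul]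

end PLambdaData

/-! ### The theorem -/

section Main

variable {m : ℕ}

/-- **LMR 2013, Prop. 3.5.2, `⊆`: the gradient of `P_Λ` at every point of its zero set is of the
form `v² ⊕ v ∧ w`** — `∂_{ij}P_Λ(x) = v_i v_j + (v_i w_j − v_j w_i)` with `v = z(A)/√n` (Pfaffian
vector of the skew part `A` of `x`) and `w = −q/√n`, where `A q = S z(A)` (solvable since
`z(A)ᵀ S z(A) = n·P_Λ(x) = 0` and `im A = z(A)^⊥` when `z(A) ≠ 0`; if `z(A) = 0` the gradient
vanishes). Printed: "It [the dual variety] can be defined as the image of the projective bundle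
… `v² ⊕ v ∧ w`" (p. 481). [cite: LandsbergManivelRessayre2013, Proposition 3.5.2 (p. 481)] -/
theorem gradAt_pLambda_mem_vSqWedgeSet (hm : Even m) {x : Fin (m + 1) × Fin (m + 1) → ℂ}
    (hx : eval x (pLambda (m + 1)) = 0) : gradAt (pLambda (m + 1)) x ∈ vSqWedgeSet (m + 1) := by
  classical
  set A₀ := skewPt x with hA₀
  set S₀ := symPt x with hS₀
  set z₀ := pfVec A₀ with hz₀
  have hn : ((m + 1 : ℕ) : ℂ) ≠ 0 := Nat.cast_ne_zero.mpr (Nat.succ_ne_zero m)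
  have hA₀T : A₀ᵀ = -A₀ := transpose_half_sub _
  have hS₀T : S₀ᵀ = S₀ := transpose_half_add _
  by_cases hz : z₀ = 0
  · refine ⟨0, 0, fun i j => ?_⟩
    rw [gradAt_pLambda_eq hm, ← hA₀, ← hz₀, hz]
    simp
  · -- the nondegenerate case: `rank A = m`, `im A = z₀^⊥`
    have hadj : A₀.adjugate = vecMulVec z₀ z₀ :=
      adjugate_eq_vecMulVec_pfVec hm (isUnit_iff_ne_zero.mpr two_ne_zero) hA₀T (half_sub_apply_self _)
    obtain ⟨l, hl⟩ := Function.ne_iff.mp hz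
    have hcof : A₀.adjugate l l ≠ 0 := by
      rw [hadj, vecMulVec_apply]
      exact mul_ne_zero hl hl
    have hr : m ≤ A₀.rank := le_rank_of_adjugate_ne_zero hcof
    have hAz : A₀ *ᵥ z₀ = 0 :=
      mulVec_pfVec_eq_zero hm (isUnit_iff_ne_zero.mpr two_ne_zero) hA₀T (half_sub_apply_self _)
    have horth : z₀ ⬝ᵥ (S₀ *ᵥ z₀) = 0 := by
      have h := eval_pLambda_eq_dotProduct hm x
      rw [hx, ← hA₀, ← hS₀, ← hz₀] at h
      rcases mul_eq_zero.mp h.symm with h | h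
      · exact absurd h (one_div_ne_zero hn)
      · exact h
    obtain ⟨q, hq⟩ := exists_mulVec_eq_of_dotProduct_eq_zero hA₀T hz hAz hr horth
    obtain ⟨μ, hμ⟩ := IsAlgClosed.exists_pow_nat_eq (1 / ((m + 1 : ℕ) : ℂ)) two_pos
    refine ⟨μ • z₀, (-μ) • q, fun i j => ?_⟩
    -- the two cross terms both equal `qᵀ B_{ij} z₀`
    have hrel : A₀ *ᵥ dv0 (zLine x i j) = -(dirSkew i j *ᵥ z₀) := skewPt_mulVec_dv0 hm x i j
    have hcross1 : dv0 (zLine x i j) ⬝ᵥ (S₀ *ᵥ z₀) = q ⬝ᵥ (dirSkew i j *ᵥ z₀) := by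
      rw [← hq, dotProduct_mulVec, ← mulVec_transpose, hA₀T, neg_mulVec, hrel, neg_neg, dotProduct_comm]
    have hcross2 : z₀ ⬝ᵥ (S₀ *ᵥ dv0 (zLine x i j)) = q ⬝ᵥ (dirSkew i j *ᵥ z₀) := by
      rw [dotProduct_mulVec, ← mulVec_transpose, hS₀T, dotProduct_comm, ← hcross1, dotProduct_comm]
    rw [gradAt_pLambda_eq hm, ← hA₀, ← hS₀, ← hz₀, hcross1, hcross2, dotProduct_dirSkew_mulVec,
      dotProduct_dirSym_mulVec]
    simp only [Pi.smul_apply, smul_eq_mul]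
    rw [← hμ]
    ring

/-- **LMR 2013, Prop. 3.5.2, `⊆` half, on tangent hyperplanes**: for `n` odd, every tangent
hyperplane of the hypersurface `Z(P_Λ) ⊂ ℙ M_n(ℂ)` — every gradient `∇P_Λ(x)`, `P_Λ(x) = 0` — lies in
`{v² ⊕ v ∧ w : v, w ∈ ℂⁿ} ⊂ S²ℂⁿ ⊕ Λ²ℂⁿ = M_n(ℂ)` (`vSqWedgeSet`), with NO linear change of
coordinates needed. [cite: LandsbergManivelRessayre2013, Proposition 3.5.2 (p. 481)] -/
theorem tangentHyperplaneCone_pLambda_subset {n : ℕ} (hn : Odd n) :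
    tangentHyperplaneCone (pLambda n) ⊆ vSqWedgeSet n := by
  obtain ⟨k, rfl⟩ := hn
  have hm : Even (2 * k) := even_two_mul k
  rintro ξ ⟨x, hx, rfl⟩
  exact gradAt_pLambda_mem_vSqWedgeSet hm hx

/-- **LMR 2013, Prop. 3.5.2, `⊆` half**: for `n` odd, the dual variety (cone) of `Z(P_Λ)` is
contained in the Zariski closure of `{v² ⊕ v ∧ w}` — "The dual variety of the hypersurface `Z(P_Λ)`
is isomorphic to the Zariski closure of `ℙ{v² ⊕ v∧w ∈ S²ℂⁿ ⊕ Λ²ℂⁿ, v, w ∈ ℂⁿ} ⊂ ℙ(M_n(ℂ))`",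
p. 481; this is the inclusion `⊆` of the named fact `LMR2013_prop_3_5_2` (with `g = id`); the
reverse inclusion (density of the image of the projective bundle) is NOT proved here, and the named
fact stays. Partial discharge. [cite: LandsbergManivelRessayre2013, Proposition 3.5.2 (p. 481)] -/
theorem dualVarietyCone_pLambda_subset {n : ℕ} (hn : Odd n) :
    dualVarietyCone (pLambda n) ⊆ zariskiClosure (vSqWedgeSet n) :=
  zariskiClosure_mono (tangentHyperplaneCone_pLambda_subset hn)

/-- The same in the shape of the named fact `LMR2013_prop_3_5_2` (`∃ g` a linear automorphism of
`M_n(ℂ)^*` with `g '' dualVarietyCone (pLambda n) = zariskiClosure (vSqWedgeSet n)`): its `⊆` half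
holds with `g = id`, for every odd `n` (the fact asks `n ≥ 3`). [cite: LandsbergManivelRessayre2013, Proposition 3.5.2 (p. 481)] -/
theorem LMR2013_prop_3_5_2_subset {n : ℕ} (hn : Odd n) :
    ∃ g : (Fin n × Fin n → ℂ) ≃ₗ[ℂ] (Fin n × Fin n → ℂ),
      g '' dualVarietyCone (pLambda n) ⊆ zariskiClosure (vSqWedgeSet n) := by
  refine ⟨LinearEquiv.refl ℂ _, ?_⟩
  rintro _ ⟨y, hy, rfl⟩
  exact dualVarietyCone_pLambda_subset hn hy

end Main

/-! ## Appendix (val-lit p7 g2, second landing): the `⊇` half and the DISCHARGE of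
`LMR2013_prop_3_5_2`

The reverse inclusion `zariskiClosure (vSqWedgeSet n) ⊆ dualVarietyCone (pLambda n)` (`n` odd, `n ≥ 3`):
(1) the gradient formula with an explicit solution `q` of `A q = S z(A)` (`gradAt_pLambda_skew_add_sym`);
(2) `GL_n`-covariance of the gradient, `gᵀ ∇P_Λ(gMgᵀ) g = det(g)² ∇P_Λ(M)` (`gradAt_pLambda_conj`, from
the typer's `P_Λ(gMgᵀ) = det(g)² P_Λ(M)`), whence the cone of tangent hyperplanes is stable under
`ξ ↦ k ξ kᵀ`, `k ∈ GL_n` (`conj_mem_tangentHyperplaneCone_pLambda`, using an `(n−1)`-st root of `det k`);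
(3) one explicit zero of `P_Λ` (`A₀ = lmrSkewStd`, `S₀ = c₀ e₀ᵀ + e₀ c₀ᵀ`) whose gradient is
`v₀² ⊕ v₀ ∧ w₀` with `v₀, w₀` INDEPENDENT; (4) `GL_n` moves `(v₀, w₀)` to every pair `(v, w)` with
`v₀ w_{k₀} − v_{k₀} w₀ ≠ 0`; (5) a polynomial vanishing on these pairs vanishes on all of `vSqWedgeSet`.
-/

section GradientFormula

variable {m : ℕ}

/-- The skew part of the point `A + S` is `A`. [cite: LandsbergManivelRessayre2013, §3.5 (p. 480)] -/
private theorem skewPt_skew_add_sym {A S : Matrix (Fin (m + 1)) (Fin (m + 1)) ℂ} (hA : Aᵀ = -A)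
    (hS : Sᵀ = S) : skewPt (fun p : Fin (m + 1) × Fin (m + 1) => (A + S) p.1 p.2) = A := by
  have hpt : ptMat (fun p : Fin (m + 1) × Fin (m + 1) => (A + S) p.1 p.2) = A + S := by
    ext a b; rfl
  rw [skewPt, hpt, transpose_add, hA, hS]
  ext a b
  simp only [Matrix.smul_apply, Matrix.sub_apply, Matrix.add_apply, Matrix.neg_apply, smul_eq_mul]
  ring

/-- The symmetric part of the point `A + S` is `S`. [cite: LandsbergManivelRessayre2013, §3.5 (p. 480)] -/
private theorem symPt_skew_add_sym {A S : Matrix (Fin (m + 1)) (Fin (m + 1)) ℂ} (hA : Aᵀ = -A)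
    (hS : Sᵀ = S) : symPt (fun p : Fin (m + 1) × Fin (m + 1) => (A + S) p.1 p.2) = S := by
  have hpt : ptMat (fun p : Fin (m + 1) × Fin (m + 1) => (A + S) p.1 p.2) = A + S := by
    ext a b; rfl
  rw [symPt, hpt, transpose_add, hA, hS]
  ext a b
  simp only [Matrix.smul_apply, Matrix.add_apply, Matrix.neg_apply, smul_eq_mul]
  ring

/-- **The gradient of `P_Λ` at `M = A + S`** (skew + symmetric, `n = m + 1` odd), given ANY solution
`q` of `A q = S z(A)` (`z(A)` the Pfaffian vector): `∂_{ij} P_Λ(M) = (1/n)(z_i z_j + (q_i z_j − q_j z_i))`,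
i.e. `∇P_Λ(M) = (1/n)(z zᵀ + q ∧ z)` — the printed "`v² ⊕ v ∧ w`" with `v = z/√n`, `w = −q/√n`.
[cite: LandsbergManivelRessayre2013, Proposition 3.5.2 (p. 481)] -/
theorem gradAt_pLambda_skew_add_sym (hm : Even m) {A S : Matrix (Fin (m + 1)) (Fin (m + 1)) ℂ}
    (hA : Aᵀ = -A) (hS : Sᵀ = S) {q : Fin (m + 1) → ℂ} (hq : A *ᵥ q = S *ᵥ pfVec A)
    (i j : Fin (m + 1)) :
    gradAt (pLambda (m + 1)) (fun p : Fin (m + 1) × Fin (m + 1) => (A + S) p.1 p.2) (i, j) =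
      (1 / ((m + 1 : ℕ) : ℂ)) * (pfVec A i * pfVec A j + (q i * pfVec A j - q j * pfVec A i)) := by
  set x : Fin (m + 1) × Fin (m + 1) → ℂ := fun p => (A + S) p.1 p.2 with hx
  have hAx : skewPt x = A := skewPt_skew_add_sym hA hS
  have hSx : symPt x = S := symPt_skew_add_sym hA hS
  have hrel : A *ᵥ dv0 (zLine x i j) = -(dirSkew i j *ᵥ pfVec A) := by
    have h := skewPt_mulVec_dv0 hm x i j
    rwa [hAx] at h
  have hcross1 : dv0 (zLine x i j) ⬝ᵥ (S *ᵥ pfVec A) = q ⬝ᵥ (dirSkew i j *ᵥ pfVec A) := by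
    rw [← hq, dotProduct_mulVec, ← mulVec_transpose, hA, neg_mulVec, hrel, neg_neg, dotProduct_comm]
  have hcross2 : pfVec A ⬝ᵥ (S *ᵥ dv0 (zLine x i j)) = q ⬝ᵥ (dirSkew i j *ᵥ pfVec A) := by
    rw [dotProduct_mulVec, ← mulVec_transpose, hS, dotProduct_comm, ← hcross1, dotProduct_comm]
  rw [gradAt_pLambda_eq hm, hAx, hSx, hcross1, hcross2, dotProduct_dirSkew_mulVec, dotProduct_dirSym_mulVec]
  ring

end GradientFormula

/-! ### `GL_n`-covariance of the gradient -/

section Covariance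

variable {m : ℕ}

/-- `mline` of conjugated data is the conjugate of `mline` (by the constant matrix `g`). [folklore] -/
private theorem mline_conj (g M N : Matrix (Fin (m + 1)) (Fin (m + 1)) ℂ) :
    mline (g * M * gᵀ) (g * N * gᵀ) =
      g.map Polynomial.C * mline M N * (g.map Polynomial.C)ᵀ := by
  have h1 : mline M N = M.map Polynomial.C + (Polynomial.X : Polynomial ℂ) • N.map Polynomial.C := by
    refine Matrix.ext fun a b => ?_
    simp only [mline_apply, Matrix.add_apply, Matrix.map_apply, Matrix.smul_apply, smul_eq_mul]
    ring
  have h2 : mline (g * M * gᵀ) (g * N * gᵀ) = (g * M * gᵀ).map Polynomial.C +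
      (Polynomial.X : Polynomial ℂ) • (g * N * gᵀ).map Polynomial.C := by
    refine Matrix.ext fun a b => ?_
    simp only [mline_apply, Matrix.add_apply, Matrix.map_apply, Matrix.smul_apply, smul_eq_mul]
    ring
  rw [h1, h2, Matrix.map_mul, Matrix.map_mul, Matrix.map_mul, Matrix.map_mul, Matrix.transpose_map,
    Matrix.mul_add, Matrix.add_mul, Matrix.mul_smul, Matrix.smul_mul]

/-- The conjugated coordinate direction: `(g E_{ij} gᵀ)_{ab} = g_{ai} g_{bj}`. [folklore] -/
private theorem conj_dirMat_apply (g : Matrix (Fin (m + 1)) (Fin (m + 1)) ℂ) (i j a b : Fin (m + 1)) :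
    (g * dirMat i j * gᵀ) a b = g a i * g b j := by
  rw [Matrix.mul_apply]
  have h1 : ∀ c, (g * dirMat i j) a c = if c = j then g a i else 0 := by
    intro c
    rw [Matrix.mul_apply]
    simp only [dirMat, Matrix.of_apply, mul_ite, mul_one, mul_zero]
    by_cases hc : c = j
    · simp [hc]
    · simp [hc]
  simp_rw [h1]
  simp [Matrix.transpose_apply]

/-- The point function of a matrix and `linePt`: `linePt (pt M) (pt N) = pt (mline M N)`. [folklore] -/
private theorem linePt_pt (M N : Matrix (Fin (m + 1)) (Fin (m + 1)) ℂ) :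
    linePt (fun p : Fin (m + 1) × Fin (m + 1) => M p.1 p.2) (fun p => N p.1 p.2) =
      fun p => mline M N p.1 p.2 := by
  funext p
  rfl

/-- The gradient entry `∂_{ij}P_Λ(M)` as `d/dε P_Λ(M + ε E_{ij})|₀` in matrix form. [folklore] -/
private theorem gradAt_pLambda_pt (M : Matrix (Fin (m + 1)) (Fin (m + 1)) ℂ) (i j : Fin (m + 1)) :
    gradAt (pLambda (m + 1)) (fun p : Fin (m + 1) × Fin (m + 1) => M p.1 p.2) (i, j) =
      Polynomial.eval 0 (Polynomial.derivative
        (aeval (fun p : Fin (m + 1) × Fin (m + 1) => mline M (dirMat i j) p.1 p.2) (pLambda (m + 1)))) := by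
  rw [gradAt_eq_eval_zero_derivative, linePt_eq_mline]
  have hpt : ptMat (fun p : Fin (m + 1) × Fin (m + 1) => M p.1 p.2) = M := by ext a b; rfl
  rw [hpt]

/-- **`GL_n`-covariance of the gradient of `P_Λ`**: for every square `g` and `M`,
`Σ_{a,b} g_{ai} g_{bj} ∂_{ab}P_Λ(gMgᵀ) = det(g)² ∂_{ij}P_Λ(M)`, i.e. `gᵀ ∇P_Λ(gMgᵀ) g = det(g)² ∇P_Λ(M)`
— the derivative of the printed covariance `P_Λ(gMgᵀ) = det(g)² P_Λ(M)` ("The action of `GL_n(ℂ)` …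
preserves `P_Λ` up to scale", p. 481; tree: `aeval_pLambda_conj`).
[cite: LandsbergManivelRessayre2013, Proposition 3.5.1, proof (p. 481)] -/
theorem gradAt_pLambda_conj (g M : Matrix (Fin (m + 1)) (Fin (m + 1)) ℂ) (i j : Fin (m + 1)) :
    ∑ a, ∑ b, g a i * g b j *
        gradAt (pLambda (m + 1)) (fun p : Fin (m + 1) × Fin (m + 1) => (g * M * gᵀ) p.1 p.2) (a, b) =
      g.det ^ 2 * gradAt (pLambda (m + 1)) (fun p : Fin (m + 1) × Fin (m + 1) => M p.1 p.2) (i, j) := by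
  -- the left side is the directional derivative along `g E_{ij} gᵀ` at `g M gᵀ`
  have hdir := eval_zero_derivative_aeval_linePt (pLambda (m + 1))
    (fun p : Fin (m + 1) × Fin (m + 1) => (g * M * gᵀ) p.1 p.2)
    (fun p : Fin (m + 1) × Fin (m + 1) => (g * dirMat i j * gᵀ) p.1 p.2)
  rw [Fintype.sum_prod_type] at hdir
  simp_rw [← conj_dirMat_apply g i j]
  rw [show (∑ a, ∑ b, (g * dirMat i j * gᵀ) a b *
      gradAt (pLambda (m + 1)) (fun p : Fin (m + 1) × Fin (m + 1) => (g * M * gᵀ) p.1 p.2) (a, b)) = _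
      from hdir.symm, linePt_pt, mline_conj, aeval_pLambda_conj, ← RingHom.mapMatrix_apply,
    ← RingHom.map_det, ← map_pow, Polynomial.derivative_C_mul, Polynomial.eval_mul, Polynomial.eval_C,
    gradAt_pLambda_pt]

/-- `(gᵀ X g)_{ij} = Σ_{a,b} g_{ai} g_{bj} X_{ab}`. [folklore] -/
private theorem transpose_mul_mul_apply (g X : Matrix (Fin (m + 1)) (Fin (m + 1)) ℂ) (i j : Fin (m + 1)) :
    (gᵀ * X * g) i j = ∑ a, ∑ b, g a i * g b j * X a b := by
  rw [Matrix.mul_apply, Finset.sum_comm]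
  refine Finset.sum_congr rfl fun a _ => ?_
  rw [Matrix.mul_apply, Finset.sum_mul]
  refine Finset.sum_congr rfl fun b _ => ?_
  rw [Matrix.transpose_apply]
  ring

/-- Matrix form of the covariance: `gᵀ ∇P_Λ(gMgᵀ) g = det(g)² ∇P_Λ(M)`.
[cite: LandsbergManivelRessayre2013, Proposition 3.5.1, proof (p. 481)] -/
theorem transpose_mul_gradAt_pLambda_mul (g M : Matrix (Fin (m + 1)) (Fin (m + 1)) ℂ) :
    gᵀ * ptMat (gradAt (pLambda (m + 1)) (fun p : Fin (m + 1) × Fin (m + 1) => (g * M * gᵀ) p.1 p.2)) * g =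
      g.det ^ 2 • ptMat (gradAt (pLambda (m + 1)) (fun p : Fin (m + 1) × Fin (m + 1) => M p.1 p.2)) := by
  ext i j
  rw [transpose_mul_mul_apply, Matrix.smul_apply, smul_eq_mul]
  exact gradAt_pLambda_conj g M i j

/-- **The cone of tangent hyperplanes of `Z(P_Λ)` is `GL_n`-stable**: if `ξ` is a gradient of `P_Λ` at
a zero, so is `k ξ kᵀ` for every invertible `k` (`n = m + 1 ≥ 2`; uses an `m`-th root `d` of `det k`
and the point `g M gᵀ`, `g = d · (k⁻¹)ᵀ`). [cite: LandsbergManivelRessayre2013, Proposition 3.5.2 (p. 481)] -/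
theorem conj_mem_tangentHyperplaneCone_pLambda (hm : 0 < m) {ξ : Fin (m + 1) × Fin (m + 1) → ℂ}
    (hξ : ξ ∈ tangentHyperplaneCone (pLambda (m + 1))) {k : Matrix (Fin (m + 1)) (Fin (m + 1)) ℂ}
    (hk : IsUnit k) :
    (fun p : Fin (m + 1) × Fin (m + 1) => (k * ptMat ξ * kᵀ) p.1 p.2) ∈
      tangentHyperplaneCone (pLambda (m + 1)) := by
  obtain ⟨x, hx0, rfl⟩ := hξ
  obtain ⟨u, rfl⟩ := hk
  set k : Matrix (Fin (m + 1)) (Fin (m + 1)) ℂ := ↑u with hkdef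
  set k' : Matrix (Fin (m + 1)) (Fin (m + 1)) ℂ := ↑u⁻¹ with hk'def
  have hkk' : k * k' = 1 := by rw [hkdef, hk'def, ← Units.val_mul, mul_inv_cancel, Units.val_one]
  have hk'k : k' * k = 1 := by rw [hkdef, hk'def, ← Units.val_mul, inv_mul_cancel, Units.val_one]
  have hdetk : k.det * k'.det = 1 := by rw [← det_mul, hkk', det_one]
  have hdetk0 : k.det ≠ 0 := fun h => by rw [h, zero_mul] at hdetk; exact zero_ne_one hdetk
  obtain ⟨d, hd⟩ := IsAlgClosed.exists_pow_nat_eq k.det hm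
  have hd0 : d ≠ 0 := by
    rintro rfl
    rw [zero_pow hm.ne'] at hd
    exact hdetk0 hd.symm
  set M := ptMat x with hM
  have hxM : x = fun p : Fin (m + 1) × Fin (m + 1) => M p.1 p.2 := by funext p; simp [hM, ptMat]
  set g : Matrix (Fin (m + 1)) (Fin (m + 1)) ℂ := d • k'ᵀ with hg
  have hdetg : g.det = d := by
    rw [hg, det_smul, det_transpose, Fintype.card_fin, pow_succ]
    calc d ^ m * d * k'.det = d * (d ^ m * k'.det) := by ring
      _ = d := by rw [hd, hdetk, mul_one]
  -- the new point
  refine ⟨fun p => (g * M * gᵀ) p.1 p.2, ?_, ?_⟩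
  · have hx0' : eval x (pLambda (m + 1)) = 0 := hx0
    show eval (fun p : Fin (m + 1) × Fin (m + 1) => (g * M * gᵀ) p.1 p.2) (pLambda (m + 1)) = 0
    rw [eval_pLambda_conj, ← hxM, hx0', mul_zero]
  · set G' := ptMat (gradAt (pLambda (m + 1))
      (fun p : Fin (m + 1) × Fin (m + 1) => (g * M * gᵀ) p.1 p.2)) with hG'
    set G := ptMat (gradAt (pLambda (m + 1)) x) with hGdef
    have hcov : gᵀ * G' * g = d ^ 2 • G := by
      have h := transpose_mul_gradAt_pLambda_mul g M
      rw [← hxM, hdetg] at h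
      exact h
    have h1 : k * gᵀ = d • (1 : Matrix (Fin (m + 1)) (Fin (m + 1)) ℂ) := by
      rw [hg, transpose_smul, transpose_transpose, Matrix.mul_smul, hkk']
    have h2 : g * kᵀ = d • (1 : Matrix (Fin (m + 1)) (Fin (m + 1)) ℂ) := by
      rw [hg, Matrix.smul_mul, ← transpose_mul, hkk', transpose_one]
    have h3 : k * (gᵀ * G' * g) * kᵀ = d ^ 2 • (k * G * kᵀ) := by
      rw [hcov, Matrix.mul_smul, Matrix.smul_mul]
    have h4 : k * (gᵀ * G' * g) * kᵀ = d ^ 2 • G' := by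
      rw [show k * (gᵀ * G' * g) * kᵀ = (k * gᵀ) * G' * (g * kᵀ) by simp only [Matrix.mul_assoc], h1, h2,
        Matrix.smul_mul, Matrix.mul_smul, Matrix.one_mul, Matrix.mul_one, smul_smul, sq]
    rw [h4] at h3
    have hG : G' = k * G * kᵀ := smul_right_injective _ (pow_ne_zero 2 hd0) h3
    funext p
    have := congrFun (congrFun hG p.1) p.2
    simpa [hG', ptMat] using this

end Covariance

/-! ### One explicit tangent hyperplane `v₀² ⊕ v₀ ∧ w₀` with `v₀, w₀` independent -/

section BasePoint

variable (h : ℕ)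

/-- Over `ℂ`, an alternating matrix has zero diagonal. [folklore] -/
private theorem apply_self_eq_zero_of_transpose_eq_neg' {ι : Type*} {A : Matrix ι ι ℂ} (hA : Aᵀ = -A)
    (a : ι) : A a a = 0 := by
  have h1 := congrFun (congrFun hA a) a
  rw [transpose_apply, neg_apply] at h1
  have h2 : (2 : ℂ) * A a a = 0 := by rw [two_mul]; nth_rw 1 [h1]; exact neg_add_cancel _
  exact (mul_eq_zero.mp h2).resolve_left two_ne_zero

/-- The typer's witness `A₀ = lmrSkewStd h` (index `0` isolated, the symplectic block on `1, …, 2h`)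
is alternating (its defining lemmas in `LMR13BoundaryFormNotCone.lean` are private; re-derived from
the public definition). [folklore] -/
private theorem lmrSkewStd_transpose_eq_neg : (lmrSkewStd h)ᵀ = -lmrSkewStd h := by
  ext i j
  refine Fin.cases ?_ (fun a => ?_) i <;> refine Fin.cases ?_ (fun b => ?_) j
  · simp [lmrSkewStd]
  · simp [lmrSkewStd]
  · simp [lmrSkewStd]
  · have hJ := congr_fun (congr_fun (Matrix.J_transpose (Fin h) ℂ) (finSumFinEquiv.symm b))
      (finSumFinEquiv.symm a)
    simp only [Matrix.transpose_apply, Matrix.neg_apply] at hJ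
    simp [lmrSkewStd, lmrSympl, hJ]

/-- Row `0` of `A₀` vanishes. [folklore] -/
private theorem lmrSkewStd_zero_apply (j : Fin (h + h + 1)) : lmrSkewStd h 0 j = 0 := by
  simp [lmrSkewStd]

/-- The `(0,0)` minor of `A₀` is the symplectic matrix, of nonzero determinant. [folklore] -/
private theorem det_lmrSkewStd_submatrix_succ_ne_zero :
    ((lmrSkewStd h).submatrix Fin.succ Fin.succ).det ≠ 0 := by
  have h1 : (lmrSkewStd h).submatrix Fin.succ Fin.succ = lmrSympl h := by
    ext a b
    simp [lmrSkewStd]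
  rw [h1, lmrSympl, Matrix.det_reindex_self]
  exact (Matrix.isUnit_det_J (Fin h) ℂ).ne_zero

/-- `adj(A₀) = z(A₀) z(A₀)ᵀ` for the witness. [cite: LandsbergManivelRessayre2013, §3.5 (p. 480)] -/
private theorem adjugate_lmrSkewStd_eq_vecMulVec :
    (lmrSkewStd h).adjugate = vecMulVec (pfVec (lmrSkewStd h)) (pfVec (lmrSkewStd h)) :=
  adjugate_eq_vecMulVec_pfVec ⟨h, rfl⟩ (isUnit_iff_ne_zero.mpr two_ne_zero)
    (lmrSkewStd_transpose_eq_neg h)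
    (apply_self_eq_zero_of_transpose_eq_neg' (lmrSkewStd_transpose_eq_neg h))

/-- The Pfaffian vector of `A₀` vanishes off the index `0` (the corresponding principal minors contain
the zero row `0`). [folklore] -/
private theorem pfVec_lmrSkewStd_succ (hh : 0 < h) (a : Fin (h + h)) : pfVec (lmrSkewStd h) a.succ = 0 := by
  haveI : NeZero (h + h) := ⟨by omega⟩
  have hkk := congrFun (congrFun (adjugate_lmrSkewStd_eq_vecMulVec h) a.succ) a.succ
  rw [vecMulVec_apply, adjugate_fin_succ_eq_det_submatrix] at hkk
  have hdet : ((lmrSkewStd h).submatrix a.succ.succAbove a.succ.succAbove).det = 0 := by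
    refine Matrix.det_eq_zero_of_row_eq_zero 0 fun c => ?_
    rw [Matrix.submatrix_apply, Fin.succ_succAbove_zero]
    exact lmrSkewStd_zero_apply h _
  rw [hdet, mul_zero] at hkk
  exact mul_self_eq_zero.mp hkk.symm

/-- … and does not vanish at the index `0` (the minor there is `det J ≠ 0`). [folklore] -/
private theorem pfVec_lmrSkewStd_zero_ne_zero : pfVec (lmrSkewStd h) 0 ≠ 0 := by
  have h00 := congrFun (congrFun (adjugate_lmrSkewStd_eq_vecMulVec h) 0) 0
  rw [vecMulVec_apply, adjugate_fin_succ_eq_det_submatrix, Fin.succAbove_zero] at h00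
  intro hz
  rw [hz, mul_zero, Fin.val_zero, add_zero, pow_zero, one_mul] at h00
  exact det_lmrSkewStd_submatrix_succ_ne_zero h h00

/-- Hence `z(A₀) = λ e₀` with `λ = z(A₀)₀ ≠ 0`. [folklore] -/
private theorem pfVec_lmrSkewStd_eq (hh : 0 < h) :
    pfVec (lmrSkewStd h) = pfVec (lmrSkewStd h) 0 • (Pi.single 0 1 : Fin (h + h + 1) → ℂ) := by
  funext k
  refine Fin.cases ?_ (fun a => ?_) k
  · simp
  · rw [pfVec_lmrSkewStd_succ h hh a, Pi.smul_apply, Pi.single_eq_of_ne (Fin.succ_ne_zero a), smul_zero]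

/-- **An explicit tangent hyperplane of `Z(P_Λ)` of the form `v₀² ⊕ v₀ ∧ w₀` with `v₀, w₀` linearly
independent** (`n = 2h + 1 ≥ 3`): at the zero `M₀ = A₀ + S₀`, `A₀ = lmrSkewStd h` (kernel `ℂe₀`),
`S₀ = c₀ e₀ᵀ + e₀ c₀ᵀ` with `c₀ = A₀ e_{k₀}`, one has `q = λ e_{k₀}` and
`∇P_Λ(M₀) = (λ²/n)(e₀e₀ᵀ + e_{k₀} ∧ e₀)`; independence is recorded as the non-vanishing of the minor
`v₀(0) w₀(k₀) − v₀(k₀) w₀(0)`. [cite: LandsbergManivelRessayre2013, Proposition 3.5.2 (p. 481)] -/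
theorem exists_indep_mem_tangentHyperplaneCone_pLambda (hh : 0 < h) (j₀ : Fin (h + h)) :
    ∃ v w : Fin (h + h + 1) → ℂ,
      v 0 * w j₀.succ - v j₀.succ * w 0 ≠ 0 ∧
      (fun p : Fin (h + h + 1) × Fin (h + h + 1) => v p.1 * v p.2 + (v p.1 * w p.2 - v p.2 * w p.1)) ∈
        tangentHyperplaneCone (pLambda (h + h + 1)) := by
  classical
  set A₀ := lmrSkewStd h with hA₀def
  set k₀ : Fin (h + h + 1) := j₀.succ with hk₀
  have hk₀0 : k₀ ≠ 0 := Fin.succ_ne_zero j₀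
  set lam : ℂ := pfVec A₀ 0 with hlam
  set e₀ : Fin (h + h + 1) → ℂ := Pi.single 0 1 with he₀
  set c₀ : Fin (h + h + 1) → ℂ := A₀ *ᵥ Pi.single k₀ 1 with hc₀
  set S₀ : Matrix (Fin (h + h + 1)) (Fin (h + h + 1)) ℂ := vecMulVec c₀ e₀ + vecMulVec e₀ c₀ with hS₀
  have hA : A₀ᵀ = -A₀ := lmrSkewStd_transpose_eq_neg h
  have hS : S₀ᵀ = S₀ := by
    rw [hS₀, transpose_add, transpose_vecMulVec, transpose_vecMulVec]
    exact add_comm _ _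
  have hz : pfVec A₀ = lam • e₀ := pfVec_lmrSkewStd_eq h hh
  have hlam0 : lam ≠ 0 := pfVec_lmrSkewStd_zero_ne_zero h
  have hc00 : c₀ 0 = 0 := by
    rw [hc₀, mulVec_single_one]
    exact lmrSkewStd_zero_apply h k₀
  -- `S₀ e₀ = c₀`
  have hSe : S₀ *ᵥ e₀ = c₀ := by
    funext a
    rw [hS₀, add_mulVec, Pi.add_apply, vecMulVec_mulVec, vecMulVec_mulVec, he₀, dotProduct_single_one,
      dotProduct_single_one, Pi.single_eq_same, hc00]
    simp
  set q : Fin (h + h + 1) → ℂ := lam • (Pi.single k₀ 1 : Fin (h + h + 1) → ℂ) with hqdef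
  have hq : A₀ *ᵥ q = S₀ *ᵥ pfVec A₀ := by
    rw [hqdef, mulVec_smul, hz, mulVec_smul, hSe]
  -- the zero of `P_Λ`
  have hzero : eval (fun p : Fin (h + h + 1) × Fin (h + h + 1) => (A₀ + S₀) p.1 p.2)
      (pLambda (h + h + 1)) = 0 := by
    rw [eval_pLambda_skew_add_sym hA hS, adjugate_lmrSkewStd_eq_vecMulVec, trace_vecMulVec_mul, ← hq,
      hqdef, mulVec_smul, ← hc₀, hz, smul_dotProduct, dotProduct_smul, he₀, single_one_dotProduct, hc00]
    simp
  -- the square root of `1/n`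
  obtain ⟨μ, hμ⟩ := IsAlgClosed.exists_pow_nat_eq (1 / ((h + h + 1 : ℕ) : ℂ)) two_pos
  have hμ0 : μ ≠ 0 := by
    rintro rfl
    rw [zero_pow two_ne_zero] at hμ
    exact one_div_ne_zero (Nat.cast_ne_zero.mpr (Nat.succ_ne_zero _)) hμ.symm
  refine ⟨(μ * lam) • e₀, (-(μ * lam)) • (Pi.single k₀ 1 : Fin (h + h + 1) → ℂ), ?_, ?_⟩
  · -- independence
    have e1 : ((μ * lam) • e₀) 0 = μ * lam := by simp [he₀]
    have e2 : ((μ * lam) • e₀) k₀ = 0 := by simp [he₀, Pi.single_eq_of_ne hk₀0]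
    have e3 : ((-(μ * lam)) • (Pi.single k₀ 1 : Fin (h + h + 1) → ℂ)) k₀ = -(μ * lam) := by simp
    have e4 : ((-(μ * lam)) • (Pi.single k₀ 1 : Fin (h + h + 1) → ℂ)) 0 = 0 := by
      simp [Pi.single_eq_of_ne hk₀0.symm]
    rw [e1, e2, e3, e4, zero_mul, sub_zero]
    exact mul_ne_zero (mul_ne_zero hμ0 hlam0) (neg_ne_zero.mpr (mul_ne_zero hμ0 hlam0))
  · -- membership: it is the gradient at the zero `A₀ + S₀`
    refine ⟨fun p => (A₀ + S₀) p.1 p.2, hzero, ?_⟩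
    funext p
    obtain ⟨i, j⟩ := p
    rw [gradAt_pLambda_skew_add_sym ⟨h, rfl⟩ hA hS hq i j, hz, hqdef]
    simp only [Pi.smul_apply, smul_eq_mul]
    rw [← hμ]
    ring

end BasePoint

/-! ### `GL_n` moves the base pair to every pair with non-vanishing minor -/

section Transitivity

variable {m : ℕ}

/-- For `v, w` with `v₀ w_{k₀} − v_{k₀} w₀ ≠ 0` there is an invertible `k` with `k e₀ = v`, `k e_{k₀} = w`
(columns `0`, `k₀` of the identity replaced by `v`, `w`; its kernel is trivial by the `2 × 2` minor).
[folklore] -/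
private theorem exists_isUnit_mulVec_single_eq {k₀ : Fin (m + 1)} (hk₀ : k₀ ≠ 0)
    {v w : Fin (m + 1) → ℂ} (hD : v 0 * w k₀ - v k₀ * w 0 ≠ 0) :
    ∃ k : Matrix (Fin (m + 1)) (Fin (m + 1)) ℂ,
      IsUnit k ∧ k *ᵥ Pi.single 0 1 = v ∧ k *ᵥ Pi.single k₀ 1 = w := by
  classical
  set D : Matrix (Fin (m + 1)) (Fin (m + 1)) ℂ :=
    Matrix.of fun a b => if a = b then (if a ≠ 0 ∧ a ≠ k₀ then 1 else 0) else 0 with hDdef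
  set k : Matrix (Fin (m + 1)) (Fin (m + 1)) ℂ :=
    vecMulVec v (Pi.single 0 1) + vecMulVec w (Pi.single k₀ 1) + D with hkdef
  have hDmul : ∀ x : Fin (m + 1) → ℂ, ∀ a,
      (D *ᵥ x) a = if a ≠ 0 ∧ a ≠ k₀ then x a else 0 := by
    intro x a
    simp only [mulVec, dotProduct, hDdef, Matrix.of_apply, ite_mul, zero_mul, one_mul,
      Finset.sum_ite_eq, Finset.mem_univ, if_true]
  have hkmul : ∀ x : Fin (m + 1) → ℂ, ∀ a,
      (k *ᵥ x) a = x 0 * v a + x k₀ * w a + (if a ≠ 0 ∧ a ≠ k₀ then x a else 0) := by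
    intro x a
    rw [hkdef, add_mulVec, add_mulVec, Pi.add_apply, Pi.add_apply, vecMulVec_mulVec, vecMulVec_mulVec,
      single_one_dotProduct, single_one_dotProduct, hDmul]
    simp [mul_comm]
  have hker : ∀ x : Fin (m + 1) → ℂ, k *ᵥ x = 0 → x = 0 := by
    intro x hx
    have e1 := congrFun hx 0
    have e2 := congrFun hx k₀
    rw [hkmul, Pi.zero_apply] at e1 e2
    simp only [ne_eq, not_true_eq_false, false_and, if_false, add_zero] at e1
    simp only [ne_eq, hk₀, not_false_eq_true, not_true_eq_false, and_false, if_false, add_zero] at e2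
    have hx0 : x 0 = 0 := by
      have : x 0 * (v 0 * w k₀ - v k₀ * w 0) = 0 := by linear_combination w k₀ * e1 - w 0 * e2
      exact (mul_eq_zero.mp this).resolve_right hD
    have hxk : x k₀ = 0 := by
      have : x k₀ * (v 0 * w k₀ - v k₀ * w 0) = 0 := by linear_combination v 0 * e2 - v k₀ * e1
      exact (mul_eq_zero.mp this).resolve_right hD
    funext a
    have ea := congrFun hx a
    rw [hkmul, hx0, hxk, zero_mul, zero_mul, zero_add, zero_add, Pi.zero_apply] at ea
    by_cases ha : a ≠ 0 ∧ a ≠ k₀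
    · rwa [if_pos ha] at ea
    · push Not at ha
      by_cases ha0 : a = 0
      · rw [ha0, hx0, Pi.zero_apply]
      · rw [ha ha0, hxk, Pi.zero_apply]
  refine ⟨k, ?_, ?_, ?_⟩
  · rw [← Matrix.mulVec_injective_iff_isUnit]
    intro x y hxy
    rw [← sub_eq_zero]
    exact hker _ (by rw [mulVec_sub, hxy, sub_self])
  · funext a
    rw [hkmul, Pi.single_eq_same, Pi.single_eq_of_ne hk₀, one_mul, zero_mul, add_zero]
    by_cases ha : a ≠ 0 ∧ a ≠ k₀
    · rw [if_pos ha, Pi.single_eq_of_ne ha.1, add_zero]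
    · rw [if_neg ha, add_zero]
  · funext a
    rw [hkmul, Pi.single_eq_same, Pi.single_eq_of_ne hk₀.symm, one_mul, zero_mul, zero_add]
    by_cases ha : a ≠ 0 ∧ a ≠ k₀
    · rw [if_pos ha, Pi.single_eq_of_ne ha.2, add_zero]
    · rw [if_neg ha, add_zero]

/-- `k (v² ⊕ v ∧ w) kᵀ = (kv)² ⊕ (kv) ∧ (kw)`. [folklore] -/
private theorem conj_vSqWedge (k : Matrix (Fin (m + 1)) (Fin (m + 1)) ℂ) (v w : Fin (m + 1) → ℂ) :
    k * ptMat (fun p : Fin (m + 1) × Fin (m + 1) => v p.1 * v p.2 + (v p.1 * w p.2 - v p.2 * w p.1)) * kᵀ =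
      ptMat (fun p : Fin (m + 1) × Fin (m + 1) =>
        (k *ᵥ v) p.1 * (k *ᵥ v) p.2 + ((k *ᵥ v) p.1 * (k *ᵥ w) p.2 - (k *ᵥ v) p.2 * (k *ᵥ w) p.1)) := by
  have h1 : ptMat (fun p : Fin (m + 1) × Fin (m + 1) => v p.1 * v p.2 + (v p.1 * w p.2 - v p.2 * w p.1)) =
      vecMulVec v v + (vecMulVec v w - vecMulVec w v) := by
    ext a b
    simp [ptMat, vecMulVec_apply, mul_comm]
  have h2 : ptMat (fun p : Fin (m + 1) × Fin (m + 1) =>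
      (k *ᵥ v) p.1 * (k *ᵥ v) p.2 + ((k *ᵥ v) p.1 * (k *ᵥ w) p.2 - (k *ᵥ v) p.2 * (k *ᵥ w) p.1)) =
      vecMulVec (k *ᵥ v) (k *ᵥ v) + (vecMulVec (k *ᵥ v) (k *ᵥ w) - vecMulVec (k *ᵥ w) (k *ᵥ v)) := by
    ext a b
    simp [ptMat, vecMulVec_apply, mul_comm]
  have hconj : ∀ a b : Fin (m + 1) → ℂ, k * vecMulVec a b * kᵀ = vecMulVec (k *ᵥ a) (k *ᵥ b) := by
    intro a b
    rw [mul_vecMulVec, vecMulVec_mul, vecMul_transpose]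
  rw [h1, h2, Matrix.mul_add, Matrix.add_mul, Matrix.mul_sub, Matrix.sub_mul, hconj, hconj, hconj]

end Transitivity

/-! ### Density and the discharge -/

section Discharge

/-- **Every `v² ⊕ v ∧ w` with `v₀ w_{k₀} − v_{k₀} w₀ ≠ 0` is a tangent hyperplane of `Z(P_Λ)`**
(`n = 2h + 1 ≥ 3`, `k₀ = 1`): transport the base point by the invertible `k` with `k v₀ = v`, `k w₀ = w`
(up to the scalars). [cite: LandsbergManivelRessayre2013, Proposition 3.5.2 (p. 481)] -/
theorem vSqWedge_mem_tangentHyperplaneCone_pLambda (h : ℕ) (hh : 0 < h) {v w : Fin (h + h + 1) → ℂ}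
    (hD : v 0 * w (Fin.succ ⟨0, by omega⟩) - v (Fin.succ ⟨0, by omega⟩) * w 0 ≠ 0) :
    (fun p : Fin (h + h + 1) × Fin (h + h + 1) => v p.1 * v p.2 + (v p.1 * w p.2 - v p.2 * w p.1)) ∈
      tangentHyperplaneCone (pLambda (h + h + 1)) := by
  classical
  set j₀ : Fin (h + h) := ⟨0, by omega⟩ with hj₀
  set k₀ : Fin (h + h + 1) := j₀.succ with hk₀
  have hk₀0 : k₀ ≠ 0 := Fin.succ_ne_zero j₀
  obtain ⟨v₀, w₀, hD₀, hmem₀⟩ := exists_indep_mem_tangentHyperplaneCone_pLambda h hh j₀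
  -- normalise the base pair to `(e₀, e_{k₀})` coordinates: find `k` with `k v₀ = v`, `k w₀ = w`
  -- first an invertible `k₁` with `k₁ e₀ = v₀`, `k₁ e_{k₀} = w₀`, then `k₂` with `k₂ e₀ = v`, `k₂ e_{k₀} = w`
  obtain ⟨k₁, hk₁, hk₁v, hk₁w⟩ := exists_isUnit_mulVec_single_eq hk₀0 hD₀
  obtain ⟨k₂, hk₂, hk₂v, hk₂w⟩ := exists_isUnit_mulVec_single_eq hk₀0 hD
  obtain ⟨u₁, rfl⟩ := hk₁
  set k : Matrix (Fin (h + h + 1)) (Fin (h + h + 1)) ℂ :=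
    k₂ * ((u₁⁻¹ : (Matrix (Fin (h + h + 1)) (Fin (h + h + 1)) ℂ)ˣ) : Matrix _ _ ℂ) with hkdef
  have hk : IsUnit k := hk₂.mul (Units.isUnit u₁⁻¹)
  have hinv : ∀ x : Fin (h + h + 1) → ℂ,
      ((u₁⁻¹ : (Matrix (Fin (h + h + 1)) (Fin (h + h + 1)) ℂ)ˣ) : Matrix _ _ ℂ) *ᵥ
        ((↑u₁ : Matrix (Fin (h + h + 1)) (Fin (h + h + 1)) ℂ) *ᵥ x) = x := by
    intro x
    rw [mulVec_mulVec, ← Units.val_mul, inv_mul_cancel, Units.val_one, one_mulVec]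
  have hkv : k *ᵥ v₀ = v := by
    rw [hkdef, ← mulVec_mulVec, ← hk₁v, hinv, hk₂v]
  have hkw : k *ᵥ w₀ = w := by
    rw [hkdef, ← mulVec_mulVec, ← hk₁w, hinv, hk₂w]
  have hmem := conj_mem_tangentHyperplaneCone_pLambda (m := h + h) (by omega) hmem₀ hk
  rw [conj_vSqWedge, hkv, hkw] at hmem
  have hpt : (fun p : Fin (h + h + 1) × Fin (h + h + 1) =>
      ptMat (fun p : Fin (h + h + 1) × Fin (h + h + 1) => v p.1 * v p.2 + (v p.1 * w p.2 - v p.2 * w p.1))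
        p.1 p.2) =
      fun p => v p.1 * v p.2 + (v p.1 * w p.2 - v p.2 * w p.1) := by
    funext p
    simp [ptMat]
  rwa [hpt] at hmem

/-- **LMR 2013, Prop. 3.5.2, `⊇` half**: for `n` odd, `n ≥ 3`, `vSqWedgeSet n ⊆ dualVarietyCone (pLambda n)`
— a polynomial vanishing on all tangent hyperplanes vanishes on the image of `(v, w) ↦ v² ⊕ v ∧ w`,
because it vanishes there off the hypersurface `{v₀ w₁ − v₁ w₀ = 0}` (previous theorem) and `ℂ` is
infinite (`MvPolynomial.funext`). [cite: LandsbergManivelRessayre2013, Proposition 3.5.2 (p. 481)] -/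
theorem vSqWedgeSet_subset_dualVarietyCone_pLambda (h : ℕ) (hh : 0 < h) :
    vSqWedgeSet (h + h + 1) ⊆ dualVarietyCone (pLambda (h + h + 1)) := by
  classical
  set n := h + h + 1 with hn
  set k₀ : Fin (h + h + 1) := Fin.succ ⟨0, by omega⟩ with hk₀
  rintro ξ ⟨v, w, hξ⟩
  rw [dualVarietyCone, mem_zariskiClosure_iff]
  intro p hp
  -- the polynomial map `Φ(v, w) = v² ⊕ v ∧ w` on `ℂⁿ × ℂⁿ = (Fin n ⊕ Fin n → ℂ)`
  set φ : Fin (h + h + 1) × Fin (h + h + 1) → MvPolynomial (Fin (h + h + 1) ⊕ Fin (h + h + 1)) ℂ :=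
    fun ij => X (Sum.inl ij.1) * X (Sum.inl ij.2) +
      (X (Sum.inl ij.1) * X (Sum.inr ij.2) - X (Sum.inl ij.2) * X (Sum.inr ij.1)) with hφ
  set P : MvPolynomial (Fin (h + h + 1) ⊕ Fin (h + h + 1)) ℂ := aeval φ p with hP
  set Dm : MvPolynomial (Fin (h + h + 1) ⊕ Fin (h + h + 1)) ℂ :=
    X (Sum.inl 0) * X (Sum.inr k₀) - X (Sum.inl k₀) * X (Sum.inr 0) with hDm
  -- evaluation of `P` at `(v', w')` is `p(Φ(v', w'))`
  have hevalP : ∀ y : Fin (h + h + 1) ⊕ Fin (h + h + 1) → ℂ,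
      eval y P = aeval (fun ij : Fin (h + h + 1) × Fin (h + h + 1) =>
        y (Sum.inl ij.1) * y (Sum.inl ij.2) +
          (y (Sum.inl ij.1) * y (Sum.inr ij.2) - y (Sum.inl ij.2) * y (Sum.inr ij.1))) p := by
    intro y
    have hfg : (fun i => MvPolynomial.aeval y (φ i)) = fun ij : Fin (h + h + 1) × Fin (h + h + 1) =>
        y (Sum.inl ij.1) * y (Sum.inl ij.2) +
          (y (Sum.inl ij.1) * y (Sum.inr ij.2) - y (Sum.inl ij.2) * y (Sum.inr ij.1)) := by
      funext ij
      simp [hφ]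
    rw [hP, ← MvPolynomial.aeval_eq_eval]
    show (MvPolynomial.aeval y) ((MvPolynomial.aeval φ) p) = _
    rw [← AlgHom.comp_apply, MvPolynomial.comp_aeval, hfg]
  -- `P · Dm = 0`
  have hPD : P * Dm = 0 := by
    apply MvPolynomial.funext
    intro y
    rw [map_mul, map_zero]
    by_cases hy : eval y Dm = 0
    · rw [hy, mul_zero]
    · have hD' : y (Sum.inl 0) * y (Sum.inr k₀) - y (Sum.inl k₀) * y (Sum.inr 0) ≠ 0 := by
        simpa [hDm] using hy
      have hmem := vSqWedge_mem_tangentHyperplaneCone_pLambda h hh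
        (v := fun i => y (Sum.inl i)) (w := fun i => y (Sum.inr i)) hD'
      rw [hevalP, hp _ hmem, zero_mul]
  have hDm0 : Dm ≠ 0 := by
    intro h0
    have := congrArg (eval (Sum.elim (Pi.single 0 1) (Pi.single k₀ 1))) h0
    rw [hDm, map_sub, map_mul, map_mul, eval_X, eval_X, eval_X, eval_X, map_zero] at this
    have hk0' : k₀ ≠ 0 := Fin.succ_ne_zero _
    simp only [Sum.elim_inl, Sum.elim_inr, Pi.single_eq_same, Pi.single_eq_of_ne hk0',
      Pi.single_eq_of_ne hk0'.symm, mul_one, mul_zero, sub_zero] at this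
    exact one_ne_zero this
  have hP0 : P = 0 := (mul_eq_zero.mp hPD).resolve_right hDm0
  -- conclude at `(v, w)`
  have hξ' : ξ = fun ij : Fin (h + h + 1) × Fin (h + h + 1) =>
      v ij.1 * v ij.2 + (v ij.1 * w ij.2 - v ij.2 * w ij.1) := by
    funext ij
    exact hξ ij.1 ij.2
  have := hevalP (Sum.elim v w)
  rw [hP0, map_zero] at this
  rw [hξ']
  simpa using this.symm

/-- **DISCHARGE of `LMR2013_prop_3_5_2`** (Landsberg–Manivel–Ressayre 2013, Prop. 3.5.2, p. 481: "The
dual variety of the hypersurface `Z(P_Λ)` is isomorphic to the Zariski closure of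
`ℙ{v² ⊕ v∧w ∈ S²ℂⁿ ⊕ Λ²ℂⁿ, v, w ∈ ℂⁿ} ⊂ ℙ(M_n(ℂ))`"), in the typed reading (projective equivalence;
here realised by `g = id`): for `n` odd, `n ≥ 3`, `dualVarietyCone (pLambda n) = zariskiClosure
(vSqWedgeSet n)` — `⊆` by `dualVarietyCone_pLambda_subset`, `⊇` by
`vSqWedgeSet_subset_dualVarietyCone_pLambda` and idempotence of the Zariski closure.
[cite: LandsbergManivelRessayre2013, Proposition 3.5.2 (p. 481)] -/
theorem LMR2013_prop_3_5_2_holds : LMR2013_prop_3_5_2 := by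
  intro n hn h3
  obtain ⟨h, rfl⟩ : ∃ h, n = h + h + 1 := by
    obtain ⟨k, hk⟩ := hn
    exact ⟨k, by omega⟩
  have hh : 0 < h := by omega
  refine ⟨LinearEquiv.refl ℂ _, ?_⟩
  have himage : (LinearEquiv.refl ℂ (Fin (h + h + 1) × Fin (h + h + 1) → ℂ)) ''
      dualVarietyCone (pLambda (h + h + 1)) = dualVarietyCone (pLambda (h + h + 1)) := by
    ext ξ
    simp
  rw [himage]
  refine Set.Subset.antisymm (dualVarietyCone_pLambda_subset hn) ?_
  have h1 := zariskiClosure_mono (vSqWedgeSet_subset_dualVarietyCone_pLambda h hh)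
  rwa [dualVarietyCone, zariskiClosure_zariskiClosure] at h1

end Discharge

end Literature.Computability.AlgebraicComplexity
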